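import Literature.Computability.FineGrained.RadiusToAPSPProgram
import HarnessLib

/-!
# Radius `≤₃` APSP (Abboud–Grandoni–Vassilevska Williams 2015, Thm. 1.1, the trivial direction): the verified reduction

Abboud, Grandoni and Vassilevska Williams, *Subcubic equivalences between graph centrality problems,
APSP and diameter*, SODA 2015, Thm. 1.1: Radius and APSP are equivalent under subcubic reductions,
and "one direction is trivial": solve APSP and read off `R* = min_v max_t d(v, t)`. This file proves
that direction as a fine-grained reduction in the word-RAM model of the prelude (`FGReducible`,
VVW ICM 2018, Def. 2.1):

**`radius_fgReducible_APSP_same c : FGReducible (Radius c) (n ↦ n³) (APSP c) (n ↦ n³)`**, by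
assembling the verified oracle program `RadiusToAPSP.prog` and its semantics `prog_spec`
(`Literature.Computability.FineGrained.RadiusToAPSPProgram`) with

* **the order key is an increasing recoding**: `keyOf A Hf ⌜⊤⌝ = A` and `keyOf A Hf ⌜z⌝ = Hf + z`
  for `|z| ≤ B`, `B + 1 ≤ Hf`, `Hf + B < A` (`K_coe`), so on `B`-bounded weights `a < b` iff
  `K a < K b` (`K_lt_K_iff`) and `K` is injective (`K_inj`);
* **the folds compute the radius code**: the row fold ends in `(K, ⌜·⌝)` of the row maximum
  (`rowSt_spec`, a maximum is attained and strict updates keep the first maximiser), the column fold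
  in `(A, 0)` if every row maximum is `⊤` and in `(K, ⌜·⌝)` of the minimum otherwise (`minSt_spec`),
  hence `(minSt … N).2 = ⌜min_i max_j D i j⌝` (`minSt_eq_encode`) — for `D = shortestDist W` this is
  `⌜weightedRadius W⌝`;
* budgets: word size `(c + 8) · width` (`capacity` lemmas: `A = 2 ^ w - 1 ≥ 4 B + 3` with
  `B = N · Nᶜ`, `N = n + 1`, the bound on shortest distances); for `ε > 0` take `δ = min ε (1/3)`
  and `C = 50`: time `31 N² + 17 N + 24`, one query (the input matrix itself, an `APSP c` instance
  of the same size `N`) with ledger `(N³)^{1-ε} ≤ (N³)^{1-δ}` and length `N² + 1`.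

Everything here is proved; the reduction is deterministic.

## References

* A. Abboud, F. Grandoni, V. Vassilevska Williams, *Subcubic equivalences between graph centrality
  problems, APSP and diameter*, Proc. SODA 2015, 1681–1697, Thm. 1.1 ("one direction is trivial").
  doi:10.1137/1.9781611973730.112
* V. Vassilevska Williams, *On some fine-grained questions in algorithms and complexity*, Proc. ICM
  2018, §2, Def. 2.1 (fine-grained reductions on the word RAM).
-/

namespace Literature.Computability.FineGrained

namespace RadiusToAPSP

open Cryptography Cryptography.WordRAM Cryptography.WordRAM.SProg Matrix NegTriToAPSP

/-! ### The order key is an increasing recoding of bounded weights -/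

section Key

variable {A Hf B : ℕ}

/-- The order key of a weight: `K a = keyOf A Hf ⌜a⌝`. [folklore] -/
def K (A Hf : ℕ) (a : WithTop ℤ) : ℕ := keyOf A Hf (encodeWithTopInt a)

/-- The code of a nonnegative integer `m` is `2 m + 1`. [folklore] -/
theorem encodeWithTopInt_ofNat (m : ℕ) : encodeWithTopInt ((m : ℤ) : WithTop ℤ) = 2 * m + 1 := rfl

/-- The code of the negative integer `-(m + 1)` is `2 m + 2`. [folklore] -/
theorem encodeWithTopInt_negSucc' (m : ℕ) : encodeWithTopInt ((Int.negSucc m : ℤ) : WithTop ℤ) = 2 * m + 2 := rfl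

/-- `K ⊤ = A`. [folklore] -/
theorem K_top (A Hf : ℕ) : K A Hf ⊤ = A := by
  unfold K keyOf
  exact if_pos rfl

/-- **`K ⌜z⌝ = Hf + z`** for `|z| ≤ B`, `B + 1 ≤ Hf` (as integers; the zig-zag code is decoded by
the parity arithmetic of `keyOf`). [folklore] -/
theorem K_coe {z : ℤ} (hz : |z| ≤ B) (hB : B + 1 ≤ Hf) : (K A Hf (z : WithTop ℤ) : ℤ) = Hf + z := by
  rw [abs_le] at hz
  cases z with
  | ofNat m =>
    rw [Int.ofNat_eq_natCast] at hz ⊢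
    unfold K keyOf
    rw [encodeWithTopInt_ofNat, if_neg (by omega)]
    have h1 : (2 * m + 1 - 1) / 2 = m := by omega
    have h2 : (2 * m + 1 - 1) % 2 = 0 := by omega
    rw [h1, h2, Nat.zero_mul, Nat.sub_zero]
    push_cast
    ring
  | negSucc m =>
    have hm : (m : ℤ) + 1 ≤ B := by have := hz.1; rw [Int.negSucc_eq] at this; omega
    unfold K keyOf
    rw [encodeWithTopInt_negSucc', if_neg (by omega)]
    have h1 : (2 * m + 2 - 1) / 2 = m := by omega
    have h2 : (2 * m + 2 - 1) % 2 = 1 := by omega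
    rw [h1, h2, Int.negSucc_eq]
    have hm' : m + 1 ≤ Hf := by omega
    rw [show Hf + m - 1 * (2 * m + 2 - 1) = Hf - (m + 1) by omega]
    push_cast [hm']
    ring

/-- A `B`-bounded finite weight has `Hf - B ≤ K ≤ Hf + B`. [folklore] -/
theorem K_coe_bounds {z : ℤ} (hz : |z| ≤ B) (hB : B + 1 ≤ Hf) :
    Hf ≤ K A Hf (z : WithTop ℤ) + B ∧ K A Hf (z : WithTop ℤ) ≤ Hf + B := by
  have h := K_coe (A := A) hz hB
  rw [abs_le] at hz
  constructor
  · have : (Hf : ℤ) ≤ (K A Hf (z : WithTop ℤ) : ℤ) + B := by rw [h]; omega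
    exact_mod_cast this
  · have : (K A Hf (z : WithTop ℤ) : ℤ) ≤ Hf + B := by rw [h]; omega
    exact_mod_cast this

/-- **The order key is increasing on bounded weights**: for `B`-bounded `a, b` (and `B + 1 ≤ Hf`,
`Hf + B < A`), `K a < K b ↔ a < b`. [folklore] -/
theorem K_lt_K_iff {a b : WithTop ℤ} (ha : IsBddWeight B a) (hb : IsBddWeight B b) (hB : B + 1 ≤ Hf)
    (hA : Hf + B < A) : K A Hf a < K A Hf b ↔ a < b := by
  rcases ha with rfl | ⟨z, rfl, hz⟩ <;> rcases hb with rfl | ⟨z', rfl, hz'⟩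
  · simp [K_top]
  · rw [K_top]
    have := (K_coe_bounds (A := A) hz' hB).2
    constructor
    · intro h; omega
    · intro h; exact absurd h not_top_lt
  · rw [K_top]
    have := (K_coe_bounds (A := A) hz hB).2
    exact ⟨fun _ => WithTop.coe_lt_top z, fun _ => by omega⟩
  · rw [WithTop.coe_lt_coe, ← Nat.cast_lt (α := ℤ), K_coe hz hB, K_coe hz' hB]
    omega

/-- **The order key is injective on bounded weights.** [folklore] -/
theorem K_inj {a b : WithTop ℤ} (ha : IsBddWeight B a) (hb : IsBddWeight B b) (hB : B + 1 ≤ Hf)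
    (hA : Hf + B < A) (h : K A Hf a = K A Hf b) : a = b := by
  rcases lt_trichotomy a b with hlt | heq | hgt
  · exact absurd ((K_lt_K_iff ha hb hB hA).2 hlt) (by omega)
  · exact heq
  · exact absurd ((K_lt_K_iff hb ha hB hA).2 hgt) (by omega)

/-- The order key of a bounded weight is positive. [folklore] -/
theorem K_pos {a : WithTop ℤ} (ha : IsBddWeight B a) (hB : B + 1 ≤ Hf) (hA : Hf + B < A) : 0 < K A Hf a := by
  rcases ha with rfl | ⟨z, rfl, hz⟩
  · rw [K_top]; omega
  · have := (K_coe_bounds (A := A) hz hB).1; omega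

end Key

/-! ### The folds compute the radius code -/

section Folds

variable {cd : ℕ → ℕ} {A Hf B N : ℕ}

/-- **The row fold computes the maximum**: on a row of `B`-bounded weights `f 0, …, f (N-1)` (read
through their codes `cd (i N + t) = ⌜f t⌝`), after `j ≥ 1` entries the state is
`(K (f j₀), ⌜f j₀⌝)` for a maximiser `j₀ < j` of `f` on `[0, j)`. [folklore] -/
theorem rowSt_spec {i : ℕ} {f : ℕ → WithTop ℤ} (hf : ∀ t, t < N → IsBddWeight B (f t))
    (hcd : ∀ t, t < N → cd (i * N + t) = encodeWithTopInt (f t)) (hB : B + 1 ≤ Hf) (hA : Hf + B < A) :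
    ∀ j, 1 ≤ j → j ≤ N → ∃ j₀, j₀ < j ∧
      rowSt cd A Hf N i j = (K A Hf (f j₀), encodeWithTopInt (f j₀)) ∧ ∀ t, t < j → f t ≤ f j₀
  | 0, h, _ => absurd h (by omega)
  | j + 1, _, hjN => by
    rcases Nat.eq_zero_or_pos j with rfl | hj
    · -- the first entry always replaces the initial `(0, 0)`
      refine ⟨0, Nat.zero_lt_one, ?_, fun t ht => by rw [show t = 0 by omega]⟩
      have hpos := K_pos (A := A) (Hf := Hf) (hf 0 (by omega)) hB hA
      unfold K at hpos
      have h0 := hcd 0 (by omega)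
      rw [Nat.add_zero] at h0
      rw [rowSt_succ, rowSt, Nat.add_zero, h0]
      dsimp only
      rw [if_pos hpos]
      rfl
    · obtain ⟨j₀, hj₀, hst, hmax⟩ := rowSt_spec hf hcd hB hA j hj (by omega)
      have hiff := K_lt_K_iff (A := A) (hf j₀ (by omega)) (hf j (by omega)) hB hA
      unfold K at hiff
      rw [rowSt_succ, hst, hcd j (by omega)]
      unfold K
      dsimp only
      by_cases hlt : f j₀ < f j
      · refine ⟨j, Nat.lt_succ_self j, by rw [if_pos (hiff.2 hlt)], fun t ht => ?_⟩
        rcases Nat.lt_succ_iff_lt_or_eq.1 ht with ht | rfl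
        · exact (hmax t ht).trans hlt.le
        · exact le_rfl
      · refine ⟨j₀, Nat.lt_succ_of_lt hj₀, by rw [if_neg (fun h => hlt (hiff.1 h))], fun t ht => ?_⟩
        rcases Nat.lt_succ_iff_lt_or_eq.1 ht with ht | rfl
        · exact hmax t ht
        · exact not_lt.1 hlt

/-- **The column fold computes the minimum**: if row `r < N` folds to `(K (g r), ⌜g r⌝)` for
`B`-bounded `g`, then after `r` rows the state is `(A, 0)` with all `g t = ⊤` so far, or
`(K (g r₀), ⌜g r₀⌝)` for a minimiser `r₀ < r` of `g` on `[0, r)`. [folklore] -/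
theorem minSt_spec {g : ℕ → WithTop ℤ} (hg : ∀ r, r < N → IsBddWeight B (g r))
    (hrow : ∀ r, r < N → rowSt cd A Hf N r N = (K A Hf (g r), encodeWithTopInt (g r)))
    (hB : B + 1 ≤ Hf) (hA : Hf + B < A) :
    ∀ r, r ≤ N → (minSt cd A Hf N r = (A, 0) ∧ ∀ t, t < r → g t = ⊤) ∨
      ∃ r₀, r₀ < r ∧ minSt cd A Hf N r = (K A Hf (g r₀), encodeWithTopInt (g r₀)) ∧ ∀ t, t < r → g r₀ ≤ g t
  | 0, _ => Or.inl ⟨rfl, fun t ht => absurd ht (Nat.not_lt_zero t)⟩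
  | r + 1, hrN => by
    have hr : r < N := by omega
    rcases minSt_spec hg hrow hB hA r (by omega) with ⟨hst, htop⟩ | ⟨r₀, hr₀, hst, hmin⟩
    · have hiff := K_lt_K_iff (A := A) (hg r hr) (IsBddWeight.top B) hB hA
      rw [K_top] at hiff
      rw [minSt_succ, hst, hrow r hr]
      dsimp only
      by_cases hlt : g r < ⊤
      · right
        refine ⟨r, Nat.lt_succ_self r, by rw [if_pos (hiff.2 hlt)], fun t ht => ?_⟩
        rcases Nat.lt_succ_iff_lt_or_eq.1 ht with ht | rfl
        · rw [htop t ht]; exact le_top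
        · exact le_rfl
      · left
        refine ⟨by rw [if_neg (fun h => hlt (hiff.1 h))], fun t ht => ?_⟩
        rcases Nat.lt_succ_iff_lt_or_eq.1 ht with ht | rfl
        · exact htop t ht
        · exact not_lt_top_iff.1 hlt
    · right
      have hiff := K_lt_K_iff (A := A) (hg r hr) (hg r₀ (by omega)) hB hA
      rw [minSt_succ, hst, hrow r hr]
      dsimp only
      by_cases hlt : g r < g r₀
      · refine ⟨r, Nat.lt_succ_self r, by rw [if_pos (hiff.2 hlt)], fun t ht => ?_⟩
        rcases Nat.lt_succ_iff_lt_or_eq.1 ht with ht | rfl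
        · exact hlt.le.trans (hmin t ht)
        · exact le_rfl
      · refine ⟨r₀, Nat.lt_succ_of_lt hr₀, by rw [if_neg (fun h => hlt (hiff.1 h))], fun t ht => ?_⟩
        rcases Nat.lt_succ_iff_lt_or_eq.1 ht with ht | rfl
        · exact hmin t ht
        · exact not_lt.1 hlt

/-- **The folds compute the code of `min_i max_j`.** For an `(n+1) × (n+1)` matrix `D` of `B`-bounded
weights whose codes are read row-major through `cd`, the final state's code component is
`⌜min_i max_j D i j⌝`. [folklore] -/
theorem minSt_eq_encode {n : ℕ} (D : Matrix (Fin (n + 1)) (Fin (n + 1)) (WithTop ℤ))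
    (hD : HasBoundedWeights D B)
    (hcd : ∀ i j (hi : i < n + 1) (hj : j < n + 1), cd (i * (n + 1) + j) = encodeWithTopInt (D ⟨i, hi⟩ ⟨j, hj⟩))
    (hB : B + 1 ≤ Hf) (hA : Hf + B < A) :
    (minSt cd A Hf (n + 1) (n + 1)).2 =
      encodeWithTopInt (Finset.univ.inf fun i : Fin (n + 1) =>
        Finset.univ.sup' Finset.univ_nonempty fun j => D i j) := by
  -- the row maxima
  set g : ℕ → WithTop ℤ := fun r =>
    if h : r < n + 1 then Finset.univ.sup' Finset.univ_nonempty fun j => D ⟨r, h⟩ j else ⊤ with hg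
  have hrow : ∀ r, r < n + 1 → rowSt cd A Hf (n + 1) r (n + 1) = (K A Hf (g r), encodeWithTopInt (g r)) ∧
      IsBddWeight B (g r) := by
    intro r hr
    set f : ℕ → WithTop ℤ := fun t => if h : t < n + 1 then D ⟨r, hr⟩ ⟨t, h⟩ else ⊤ with hf
    have hfb : ∀ t, t < n + 1 → IsBddWeight B (f t) := fun t ht => by
      rw [hf]; simp only [dif_pos ht]; exact hD _ _
    have hfc : ∀ t, t < n + 1 → cd (r * (n + 1) + t) = encodeWithTopInt (f t) := fun t ht => by
      rw [hf]; simp only [dif_pos ht]; exact hcd r t hr ht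
    obtain ⟨j₀, hj₀, hst, hmax⟩ := rowSt_spec hfb hfc hB hA (n + 1) (by omega) le_rfl
    have hsup : g r = f j₀ := by
      rw [hg]; simp only [dif_pos hr]
      refine le_antisymm (Finset.sup'_le _ _ fun j _ => ?_) ?_
      · have := hmax j j.is_lt
        rw [hf] at this; simp only [dif_pos j.is_lt] at this
        exact this
      · have := Finset.le_sup' (fun j => D ⟨r, hr⟩ j) (Finset.mem_univ (⟨j₀, by omega⟩ : Fin (n + 1)))
        refine le_trans (le_of_eq ?_) this
        rw [hf]; simp only [dif_pos (show j₀ < n + 1 by omega)]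
    rw [hsup]
    exact ⟨hst, hfb j₀ (by omega)⟩
  rcases minSt_spec (cd := cd) (fun r hr => (hrow r hr).2) (fun r hr => (hrow r hr).1) hB hA (n + 1) le_rfl
    with ⟨hst, htop⟩ | ⟨r₀, hr₀, hst, hmin⟩
  · -- every row maximum is `⊤`: the radius is `⊤`, code `0`
    rw [hst]
    have : (Finset.univ.inf fun i : Fin (n + 1) => Finset.univ.sup' Finset.univ_nonempty fun j => D i j) = ⊤ := by
      refine (Finset.inf_eq_top_iff _ _).2 fun i _ => ?_
      have := htop i i.is_lt
      rw [hg] at this; simp only [dif_pos i.is_lt] at this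
      exact this
    rw [this]
    rfl
  · rw [hst]
    change encodeWithTopInt (g r₀) = _
    congr 1
    refine le_antisymm (Finset.le_inf fun i _ => ?_) ?_
    · have := hmin i i.is_lt
      rw [hg] at this; simp only [dif_pos i.is_lt, dif_pos hr₀] at this
      rw [hg]; simp only [dif_pos hr₀]
      exact this
    · have := Finset.inf_le (f := fun i : Fin (n + 1) => Finset.univ.sup' Finset.univ_nonempty fun j => D i j)
        (Finset.mem_univ (⟨r₀, hr₀⟩ : Fin (n + 1)))
      refine le_trans this (le_of_eq ?_)
      rw [hg]; simp only [dif_pos hr₀]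

end Folds

/-! ### The APSP instance, the answer, the capacities -/

section Instance

variable {n : ℕ} (W : Matrix (Fin (n + 1)) (Fin (n + 1)) (WithTop ℤ))

/-- The code table of the oracle's answer reads the codes of the distance matrix row-major.
[folklore] -/
theorem cdOf_answer (D : Matrix (Fin (n + 1)) (Fin (n + 1)) (WithTop ℤ)) (i j : ℕ) (hi : i < n + 1)
    (hj : j < n + 1) : cdOf (encodeMatrixWithTop D) (i * (n + 1) + j) = encodeWithTopInt (D ⟨i, hi⟩ ⟨j, hj⟩) := by
  have hlt : i * (n + 1) + j < (n + 1) * (n + 1) := mul_add_lt_mul hi hj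
  have hlen : i * (n + 1) + j + 1 < (encodeMatrixWithTop D).length := by
    rw [encodeMatrixWithTop_length, sq]; omega
  unfold cdOf
  rw [List.getD_eq_getElem _ _ hlen]
  exact getElem_encodeMatrixWithTop_pair D ⟨i, hi⟩ ⟨j, hj⟩ hlen

/-- The words of the oracle's answer (the encoded distance matrix of a `Radius c` instance) are at
most `max (n + 1) (2 B + 1)`, `B = (n + 1) (n + 1)ᶜ`. [folklore] -/
theorem answer_entries_le (c : ℕ) (hW : HasBoundedWeights W ((n + 1) ^ c)) :
    ∀ v ∈ encodeMatrixWithTop (shortestDist W), v ≤ max (n + 1) (2 * ((n + 1) * (n + 1) ^ c) + 1) := by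
  have hd := hasBoundedWeights_shortestDist hW
  rw [Fintype.card_fin] at hd
  exact forall_mem_encodeMatrixWithTop_le hd

/-- All addresses fit: `pTop (n + 1) = 3 (n+1)² + 107 < ((n+1)² + 2)^{c+8}`. [folklore] -/
theorem pTop_lt_capacity (n c : ℕ) : pTop (n + 1) < ((n + 1) * (n + 1) + 1 + 1) ^ (c + 8) := by
  set X := (n + 1) * (n + 1) + 1 + 1 with hX
  have hX2 : 3 ≤ X := by rw [hX]; nlinarith
  have h1 : pTop (n + 1) < 64 * X := by unfold pTop; omega
  have h2 : 64 * X ≤ X ^ (c + 8) := by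
    calc 64 * X = 2 ^ 6 * X := by norm_num
      _ ≤ X ^ 6 * X := Nat.mul_le_mul_right _ (Nat.pow_le_pow_left (by omega) 6)
      _ = X ^ 7 := by ring
      _ ≤ X ^ (c + 8) := Nat.pow_le_pow_right (by omega) (by omega)
  omega

/-- The order keys fit: `4 B + 4 ≤ ((n+1)² + 2)^{c+8}`, `B = (n + 1)(n + 1)ᶜ`. [folklore] -/
theorem key_capacity (n c : ℕ) : 4 * ((n + 1) * (n + 1) ^ c) + 4 < ((n + 1) * (n + 1) + 1 + 1) ^ (c + 8) := by
  set X := (n + 1) * (n + 1) + 1 + 1 with hX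
  have hnX : n + 1 ≤ X := by rw [hX]; nlinarith
  have hX2 : 3 ≤ X := by rw [hX]; nlinarith
  have hc : (n + 1) ^ c ≤ X ^ c := Nat.pow_le_pow_left hnX c
  have h1 : 1 ≤ X ^ c := Nat.one_le_pow _ _ (by omega)
  have h2 : (n + 1) * (n + 1) ^ c ≤ X * X ^ c := Nat.mul_le_mul hnX hc
  calc 4 * ((n + 1) * (n + 1) ^ c) + 4 ≤ 8 * (X * X ^ c) := by nlinarith
    _ < X ^ 7 * (X * X ^ c) := Nat.mul_lt_mul_of_pos_right
        (lt_of_lt_of_le (by norm_num : 8 < 3 ^ 7) (Nat.pow_le_pow_left hX2 7)) (by positivity)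
    _ = X ^ (c + 8) := by ring

/-- The ledger estimate for the single query of the same size `N ≥ 1`:
`(N³)^{1-ε} ≤ (N³)^{1-δ}` for `δ ≤ ε`. [folklore] -/
theorem ledger_le_same {ε δ : ℝ} (hδε : δ ≤ ε) (n : ℕ) :
    ((((n + 1 : ℕ) : ℝ)) ^ (3 : ℝ)) ^ (1 - ε) ≤ ((((n + 1 : ℕ) : ℝ)) ^ (3 : ℝ)) ^ (1 - δ) := by
  have h1 : (1 : ℝ) ≤ ((n + 1 : ℕ) : ℝ) ^ (3 : ℝ) :=
    Real.one_le_rpow (by exact_mod_cast Nat.succ_pos n) (by norm_num)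
  exact Real.rpow_le_rpow_of_exponent_le h1 (by linarith)

end Instance

/-! ### The reduction -/

/-- **Abboud–Grandoni–Vassilevska Williams 2015, Thm. 1.1, the trivial direction (Radius `≤₃`
APSP), proved with the same weight exponent**: for every `c`, Radius of weighted digraphs with
weights in `[-Nᶜ, Nᶜ]` (`N = n + 1` vertices) reduces to APSP with weights in `[-Nᶜ, Nᶜ]` by the
verified word-RAM program `prog` — one APSP query on the input matrix itself, then an `O(N²)` fold
`min_i max_j` through order keys; word size `(c + 8) · width`; for every `ε > 0` the definition of
`FGReducible` (VVW ICM 2018, Def. 2.1) is met with `δ = min ε (1/3)` and `C = 50`.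
[cite: AbboudGrandoniVassilevskaWilliams2015, Thm. 1.1 ("one direction is trivial")] -/
theorem radius_fgReducible_APSP_same (c : ℕ) :
    FGReducible (Radius c) (fun n => (n : ℝ) ^ (3 : ℝ)) (APSP c) (fun n => (n : ℝ) ^ (3 : ℝ)) := by
  intro ε hε
  refine ⟨min ε (1 / 3), lt_min hε (by norm_num), prog.toProgram, c + 8, 50, prog_isDeterministic, ?_⟩
  intro O hO x
  obtain ⟨⟨n, W⟩, hWb, hnc⟩ := x
  change HasBoundedWeights W ((n + 1) ^ c) at hWb
  change HasNoNegativeCycle W at hnc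
  have hδ3 : min ε (1 / 3) ≤ 1 / 3 := min_le_right _ _
  have hδε : min ε (1 / 3) ≤ ε := min_le_left _ _
  have hbud0 : (0 : ℝ) ≤ ((((n + 1 : ℕ) : ℝ)) ^ (3 : ℝ)) ^ (1 - min ε (1 / 3)) :=
    Real.rpow_nonneg (Real.rpow_nonneg (Nat.cast_nonneg _) _) _
  have hsq := sq_le_budget hδ3 (n + 1)
  -- the APSP instance queried: the input matrix itself
  let y : (APSP c).Inst := ⟨⟨n + 1, W⟩, hWb, hnc⟩
  -- the bound on the distances and the word size
  set B : ℕ := (n + 1) * (n + 1) ^ c with hB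
  set w : ℕ := (c + 8) * inputWidth (inp W) with hw_def
  have hwid : inputWidth (inp W) ≤ w := inputWidth_le_mul (by omega) _
  have hcap : ∀ v, v < ((n + 1) * (n + 1) + 1 + 1) ^ (c + 8) → v < 2 ^ w := fun v hv =>
    lt_two_pow_mul_inputWidth (by rw [inp_length]; exact hv)
  have hF : pTop (n + 1) < 2 ^ w := hcap _ (pTop_lt_capacity n c)
  have hKw : 4 * B + 4 < 2 ^ w := hcap _ (key_capacity n c)
  have hw1 : 1 ≤ w := by
    rcases Nat.eq_zero_or_pos w with h0 | h
    · rw [h0] at hF; unfold pTop at hF; omega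
    · exact h
  obtain ⟨A, hA⟩ : ∃ A, 2 ^ w - 1 = A := ⟨_, rfl⟩
  obtain ⟨Hf, hHf⟩ : ∃ Hf, A / 2 = Hf := ⟨_, rfl⟩
  have hBH : B + 1 ≤ Hf := by omega
  have hHA : Hf + B < A := by omega
  -- the oracle's answer
  have hans_eq : O (inp W) = encodeMatrixWithTop (shortestDist W) := by
    have := hO y
    rw [APSP_good, Set.mem_singleton_iff] at this
    exact this
  have hlen : (O (inp W)).length = (n + 1) * (n + 1) + 1 := by
    rw [hans_eq, encodeMatrixWithTop_length, sq]
  have hn1B : n + 1 ≤ B := by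
    rw [hB]; exact Nat.le_mul_of_pos_right _ (Nat.one_le_pow _ _ (Nat.succ_pos n))
  have hCB : max (n + 1) (2 * B + 1) ≤ Hf := max_le (by omega) (by omega)
  have hansv : ∀ v ∈ O (inp W), v ≤ max (n + 1) (2 * B + 1) := by
    rw [hans_eq]; exact answer_entries_le W c hWb
  obtain ⟨st', ⟨t, ht, hex⟩, hqs, hM0, hM1⟩ :=
    prog_spec (O := O) W hwid hw1 hA hHf hF hlen hansv hCB
  -- the fold's result is the radius code
  have hres : (minSt (cdOf (O (inp W))) A Hf (n + 1) (n + 1)).2 = encodeWithTopInt (weightedRadius W) := by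
    rw [hans_eq]
    have hd : HasBoundedWeights (shortestDist W) B := by
      have := hasBoundedWeights_shortestDist hWb
      rwa [Fintype.card_fin] at this
    exact minSt_eq_encode (shortestDist W) hd (fun i j hi hj => cdOf_answer _ i j hi hj) hBH hHA
  refine ⟨st'.cfg none 0, [y], ?_, ?_, ?_, ?_, ?_⟩
  · -- the run halts within the budget
    refine haltsWithin_toProgram hex (Nat.le_floor ?_) zeroCoins
    change ((t + 1 : ℕ) : ℝ) ≤ 50 * ((((n + 1 : ℕ) : ℝ)) ^ (3 : ℝ)) ^ (1 - min ε (1 / 3)) + 50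
    have hnn : ((n + 1 : ℕ) : ℝ) ≤ ((n + 1 : ℕ) : ℝ) * (n + 1 : ℕ) := by
      exact_mod_cast Nat.le_mul_self (n + 1)
    have ht' : ((t + 1 : ℕ) : ℝ) ≤ 31 * (((n + 1 : ℕ) : ℝ) * (n + 1 : ℕ)) + 17 * (n + 1 : ℕ) + 24 := by
      exact_mod_cast (show t + 1 ≤ 31 * ((n + 1) * (n + 1)) + 17 * (n + 1) + 24 by omega)
    have h48 : ((t + 1 : ℕ) : ℝ) ≤ 48 * (((n + 1 : ℕ) : ℝ) * (n + 1 : ℕ)) + 24 := by linarith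
    linarith
  · -- the output is the accepted one
    change readOut st'.mem ∈ ({[encodeWithTopInt (weightedRadius W)]} : Set (List ℕ))
    have hout : readOut st'.mem = [st'.mem 1] := by simp [readOut, readSeg, hM0]
    rw [hout, hM1, hres]
    exact Set.mem_singleton _
  · -- the query log lists the encoding of the queried instance
    change st'.queries = [encodeMatrixWithTop W]
    exact hqs
  · -- the ledger of Def. 2.1
    simp only [List.map_cons, List.map_nil, List.sum_cons, List.sum_nil, add_zero]
    change ((((n + 1 : ℕ) : ℝ)) ^ (3 : ℝ)) ^ (1 - ε) ≤
      50 * ((((n + 1 : ℕ) : ℝ)) ^ (3 : ℝ)) ^ (1 - min ε (1 / 3)) + 50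
    have := ledger_le_same hδε n
    linarith
  · -- the total query length
    simp only [List.map_cons, List.map_nil, List.sum_cons, List.sum_nil, add_zero]
    change (((encodeMatrixWithTop W).length : ℕ) : ℝ) ≤
      50 * ((((n + 1 : ℕ) : ℝ)) ^ (3 : ℝ)) ^ (1 - min ε (1 / 3)) + 50
    rw [encodeMatrixWithTop_length]
    have e : (((n + 1) ^ 2 + 1 : ℕ) : ℝ) = ((n + 1 : ℕ) : ℝ) * (n + 1 : ℕ) + 1 := by push_cast; ring
    rw [e]
    linarith

end RadiusToAPSP

open Cryptography in
/-- **AGV 2015, Thm. 1.1 (trivial direction) in family form**: for every weight exponent `c` there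
is `c'` (namely `c`) and a subcubic fine-grained reduction from Radius with weights in `[-Nᶜ, Nᶜ]`
to APSP with weights in `[-N^{c'}, N^{c'}]`.
[cite: AbboudGrandoniVassilevskaWilliams2015, Thm. 1.1 ("one direction is trivial")] -/
theorem radius_fgReducible_APSP (c : ℕ) :
    ∃ c' : ℕ, FGReducible (Radius c) (fun n => (n : ℝ) ^ (3 : ℝ)) (APSP c') (fun n => (n : ℝ) ^ (3 : ℝ)) :=
  ⟨c, RadiusToAPSP.radius_fgReducible_APSP_same c⟩

end Literature.Computability.FineGrained
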